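import Literature.MathematicalPhysics.QuantumLattice.SpinTwistedHubbardTorus
import Literature.MathematicalPhysics.QuantumLattice.ReducedBCSTorus
import Literature.MathematicalPhysics.QuantumLattice.FermionTorusPlaneWaveInversion
import Literature.MathematicalPhysics.QuantumLattice.FreeFermionTwistedTraceFormula
import HarnessLib

/-!
# The boost-gauge twisted hopping matrix of the free electron gas on the torus: plane waves

Topic `MathematicalPhysics/QuantumLattice`, family `hubbard`. Route `HubbardSuperconductivity/
SpinStructureRigidity` inlines (items `SsrRigidity`, `SsrFreeParityCollapse`) the one-body matrix of
free electrons on the torus `(ℤ/Lℤ)²` with a uniform twist `θ` spread over the bonds in the boost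
gauge (the same phase `e^{±iθᵢ/L}` for both spins, unlike the spin twist of
`SpinTwistedHubbardTorus`):
`h(θ,μ)_{(x,σ),(x',σ')} = δ_{σσ'} Σᵢ ( [x = x' + eᵢ] (-e^{iθᵢ/L}) + [x' = x + eᵢ] (-e^{-iθᵢ/L}) ) - μ δ`.
This file gives it a NAME, `twistedOneBody L θ μ` (definitionally the inlined `Matrix.of`,
`twistedOneBody_eq_inline`), and proves:

* `twistedOneBody_apply_orb` (entries), `twistedOneBody_isHermitian`;
* `twistedOneBody_mulVec_planeWave` — **plane waves diagonalise it**: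
  `h(θ,μ) χ_k ⊗ e_τ = ξ_k(θ,μ) χ_k ⊗ e_τ` with the twisted band
  `ξ_k(θ,μ) = twistedBand L θ μ k = -2 Σᵢ cos(2πkᵢ/L - θᵢ/L) - μ` (every `L ≥ 1`: for `L ≤ 2` the
  two shift indicators may coincide, and the formula still holds termwise).

Sources: twisted boundary conditions in the boost gauge — B. S. Shastry, B. Sutherland, PRL 65
(1990) 243; D. J. Scalapino, S. R. White, S. Zhang, PRB 47 (1993) 7995, §II; plane waves on the
discrete torus — S. Friedli, Y. Velenik (2017) §10.4.
-/

noncomputable section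

namespace Literature.MathematicalPhysics.QuantumLattice

open Matrix Finset Literature.Probability.LatticeModels
open scoped ComplexConjugate

variable {L : ℕ} [NeZero L]

/-! ### The twisted one-body matrix -/

/-- **The boost-gauge twisted hopping matrix** of free electrons on the torus `(ℤ/Lℤ)²` with twist
`θ` (phase `e^{∓iθᵢ/L}` on every bond in direction `i`, the same for both spins) and chemical
potential `μ`; definitionally the `Matrix.of` inlined in the items of route
`HubbardSuperconductivity/SpinStructureRigidity`. [cite: ShastrySutherland1990] -/
def twistedOneBody (L : ℕ) [NeZero L] (θ : Fin 2 → ℝ) (μ : ℝ) :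
    Matrix (Orb (FermionTorus 2 L)) (Orb (FermionTorus 2 L)) ℂ :=
  Matrix.of fun o o' : Orb (FermionTorus 2 L) =>
    (if (ofLex o).2 = (ofLex o').2 then
      ∑ i : Fin 2, ((if ofLex (ofLex o).1 = Function.update (ofLex (ofLex o').1) i (ofLex (ofLex o').1 i + 1)
          then -Complex.exp (Complex.I * ((θ i : ℝ) : ℂ) / (L : ℂ)) else 0) +
        (if ofLex (ofLex o').1 = Function.update (ofLex (ofLex o).1) i (ofLex (ofLex o).1 i + 1)
          then -Complex.exp (-(Complex.I * ((θ i : ℝ) : ℂ) / (L : ℂ))) else 0))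
      else 0) - (if o = o' then ((μ : ℝ) : ℂ) else 0)

/-- `twistedOneBody` IS the inlined matrix (`rfl`). [folklore] -/
theorem twistedOneBody_eq_inline (θ : Fin 2 → ℝ) (μ : ℝ) :
    twistedOneBody L θ μ = Matrix.of fun o o' : Orb (FermionTorus 2 L) =>
      (if (ofLex o).2 = (ofLex o').2 then
        ∑ i : Fin 2, ((if ofLex (ofLex o).1 = Function.update (ofLex (ofLex o').1) i (ofLex (ofLex o').1 i + 1)
            then -Complex.exp (Complex.I * ((θ i : ℝ) : ℂ) / (L : ℂ)) else 0) +
          (if ofLex (ofLex o').1 = Function.update (ofLex (ofLex o).1) i (ofLex (ofLex o).1 i + 1)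
            then -Complex.exp (-(Complex.I * ((θ i : ℝ) : ℂ) / (L : ℂ))) else 0))
        else 0) - (if o = o' then ((μ : ℝ) : ℂ) else 0) := rfl

/-- **The twisted band** `ξ_k(θ,μ) = -2 Σᵢ cos(2πkᵢ/L - θᵢ/L) - μ`. [cite: ScalapinoWhiteZhang1993, §II] -/
def twistedBand (L : ℕ) (θ : Fin 2 → ℝ) (μ : ℝ) (k : TorusSite 2 L) : ℝ :=
  -2 * ∑ i : Fin 2, Real.cos (latticeMomentum L k i - θ i / L) - μ

/-- The shift indicator in the inlined form is `x = x' + eᵢ`. [folklore] -/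
theorem ofLex_eq_update_iff (x x' : FermionTorus 2 L) (i : Fin 2) :
    ofLex x = Function.update (ofLex x') i (ofLex x' i + 1) ↔ x = FermionTorus.shift x' i := by
  rw [FermionTorus.shift]
  constructor
  · intro h
    rw [← h, toLex_ofLex]
  · intro h
    rw [h, ofLex_toLex]

/-- Entries of the twisted one-body matrix between orbitals `(x,σ)`, `(y,σ')`. [folklore] -/
theorem twistedOneBody_apply_orb (θ : Fin 2 → ℝ) (μ : ℝ) (x y : FermionTorus 2 L) (σ σ' : Fin 2) :
    twistedOneBody L θ μ (orb x σ) (orb y σ') =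
      (if σ = σ' then
        ∑ i : Fin 2, ((if x = FermionTorus.shift y i then -Complex.exp (Complex.I * ((θ i : ℝ) : ℂ) / (L : ℂ)) else 0) +
          (if y = FermionTorus.shift x i then -Complex.exp (-(Complex.I * ((θ i : ℝ) : ℂ) / (L : ℂ))) else 0))
        else 0) - (if x = y ∧ σ = σ' then ((μ : ℝ) : ℂ) else 0) := by
  rw [twistedOneBody, Matrix.of_apply]
  simp only [orb, ofLex_toLex, ofLex_eq_update_iff, EmbeddingLike.apply_eq_iff_eq, Prod.mk.injEq]

/-- The twisted one-body matrix is Hermitian. [folklore] -/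
theorem twistedOneBody_isHermitian (θ : Fin 2 → ℝ) (μ : ℝ) : (twistedOneBody L θ μ).IsHermitian := by
  refine Matrix.IsHermitian.ext fun o o' => ?_
  obtain ⟨⟨x, σ⟩, rfl⟩ : ∃ p : FermionTorus 2 L × Fin 2, toLex p = o := ⟨ofLex o, toLex_ofLex o⟩
  obtain ⟨⟨y, σ'⟩, rfl⟩ : ∃ p : FermionTorus 2 L × Fin 2, toLex p = o' := ⟨ofLex o', toLex_ofLex o'⟩
  change star (twistedOneBody L θ μ (orb y σ') (orb x σ)) = twistedOneBody L θ μ (orb x σ) (orb y σ')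
  have hconj : ∀ r : ℝ, conj (Complex.exp (Complex.I * ((r : ℝ) : ℂ) / (L : ℂ))) =
      Complex.exp (-(Complex.I * ((r : ℝ) : ℂ) / (L : ℂ))) := by
    intro r
    rw [← Complex.exp_conj, map_div₀, map_mul, Complex.conj_I, Complex.conj_ofReal,
      Complex.conj_natCast, neg_mul, neg_div]
  have hconj' : ∀ r : ℝ, conj (Complex.exp (-(Complex.I * ((r : ℝ) : ℂ) / (L : ℂ)))) =
      Complex.exp (Complex.I * ((r : ℝ) : ℂ) / (L : ℂ)) := by
    intro r
    rw [← Complex.exp_conj, map_neg, map_div₀, map_mul, Complex.conj_I, Complex.conj_ofReal,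
      Complex.conj_natCast, neg_mul, neg_div, neg_neg]
  rw [twistedOneBody_apply_orb, twistedOneBody_apply_orb]
  simp only [star_sub, star_sum, star_add, apply_ite (star : ℂ → ℂ), star_zero, star_neg,
    Complex.star_def, hconj, hconj', Complex.conj_ofReal, eq_comm (a := σ') (b := σ),
    eq_comm (a := y) (b := x)]
  congr 1
  by_cases hσ : σ = σ'
  · rw [if_pos hσ, if_pos hσ]
    exact Finset.sum_congr rfl fun i _ => add_comm _ _
  · rw [if_neg hσ, if_neg hσ]

/-! ### Plane waves -/

/-- Summing the backward indicator against a character: `Σ_y [x = y + eᵢ] c χ_k(y) = c χ_k(x - eᵢ)`.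
[folklore] -/
theorem sum_ite_eq_shift_mul_torusChar (x : FermionTorus 2 L) (i : Fin 2) (c : ℂ) (k : TorusSite 2 L) :
    ∑ y : FermionTorus 2 L, (if x = FermionTorus.shift y i then c * torusChar k y.toTorusSite else 0) =
      c * torusChar k (x.toTorusSite - Pi.single i 1) := by
  rw [Finset.sum_eq_single (FermionTorus.unshift x i)]
  · rw [if_pos (FermionTorus.shift_unshift x i).symm, FermionTorus.toTorusSite_unshift]
  · intro y _ hy
    rw [if_neg]
    intro h
    exact hy (by rw [h, FermionTorus.unshift_shift])
  · exact fun h => absurd (Finset.mem_univ _) h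

/-- Summing the forward indicator against a character: `Σ_y [y = x + eᵢ] c χ_k(y) = c χ_k(x + eᵢ)`.
[folklore] -/
theorem sum_ite_shift_eq_mul_torusChar (x : FermionTorus 2 L) (i : Fin 2) (c : ℂ) (k : TorusSite 2 L) :
    ∑ y : FermionTorus 2 L, (if y = FermionTorus.shift x i then c * torusChar k y.toTorusSite else 0) =
      c * torusChar k (x.toTorusSite + Pi.single i 1) := by
  rw [Finset.sum_eq_single (FermionTorus.shift x i)]
  · rw [if_pos rfl, FermionTorus.toTorusSite_shift]
  · intro y _ hy
    rw [if_neg hy]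
  · exact fun h => absurd (Finset.mem_univ _) h

/-- The twisted Bloch phase: `e^{iθ/L} conj χ_k(eᵢ) + e^{-iθ/L} χ_k(eᵢ) = 2 cos(2πkᵢ/L - θ/L)`.
[folklore] -/
theorem exp_mul_conj_torusChar_single_add (k : TorusSite 2 L) (i : Fin 2) (r : ℝ) :
    Complex.exp (Complex.I * ((r : ℝ) : ℂ) / (L : ℂ)) * conj (torusChar k (Pi.single i 1)) +
        Complex.exp (-(Complex.I * ((r : ℝ) : ℂ) / (L : ℂ))) * torusChar k (Pi.single i 1) =
      ((2 * Real.cos (latticeMomentum L k i - r / L) : ℝ) : ℂ) := by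
  rw [torusChar_single_eq_exp, ← Complex.exp_conj]
  simp only [map_div₀, map_mul, map_ofNat, Complex.conj_ofReal, Complex.conj_I, Complex.conj_natCast]
  rw [← Complex.exp_add, ← Complex.exp_add, Complex.ofReal_mul, Complex.ofReal_ofNat, Complex.ofReal_cos,
    Complex.two_cos, add_comm]
  congr 1
  · congr 1
    simp only [latticeMomentum]
    push_cast
    ring
  · congr 1
    simp only [latticeMomentum]
    push_cast
    ring

/-- **Plane waves diagonalise the boost-gauge twisted hopping matrix**:
`h(θ,μ) (χ_k ⊗ e_τ) = ξ_k(θ,μ) (χ_k ⊗ e_τ)`, `ξ_k(θ,μ) = -2 Σᵢ cos(2πkᵢ/L - θᵢ/L) - μ`, for every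
`L ≥ 1`. [cite: ScalapinoWhiteZhang1993, §II] -/
theorem twistedOneBody_mulVec_planeWave (θ : Fin 2 → ℝ) (μ : ℝ) (k : TorusSite 2 L) (τ : Fin 2) :
    twistedOneBody L θ μ *ᵥ planeWave k τ = ((twistedBand L θ μ k : ℝ) : ℂ) • planeWave k τ := by
  funext o
  obtain ⟨⟨x, σ⟩, rfl⟩ : ∃ p : FermionTorus 2 L × Fin 2, toLex p = o := ⟨ofLex o, toLex_ofLex o⟩
  change (twistedOneBody L θ μ *ᵥ planeWave k τ) (orb x σ) =
    ((twistedBand L θ μ k : ℝ) : ℂ) * planeWave k τ (orb x σ)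
  simp only [Matrix.mulVec, dotProduct]
  rw [sum_orb_eq_sum_sum]
  simp only [twistedOneBody_apply_orb, planeWave_orb, mul_ite, mul_zero, ite_and]
  -- the spin sum collapses to `σ' = σ`
  have hσ' : ∀ y : FermionTorus 2 L, (∑ σ' : Fin 2, if σ' = τ then
      ((if σ = σ' then ∑ i : Fin 2, ((if x = FermionTorus.shift y i then
          -Complex.exp (Complex.I * ((θ i : ℝ) : ℂ) / (L : ℂ)) else 0) +
          (if y = FermionTorus.shift x i then -Complex.exp (-(Complex.I * ((θ i : ℝ) : ℂ) / (L : ℂ)))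
            else 0)) else 0) -
        (if x = y then (if σ = σ' then ((μ : ℝ) : ℂ) else 0) else 0)) * torusChar k y.toTorusSite
      else 0) =
      if σ = τ then ((∑ i : Fin 2, ((if x = FermionTorus.shift y i then
          -Complex.exp (Complex.I * ((θ i : ℝ) : ℂ) / (L : ℂ)) else 0) +
          (if y = FermionTorus.shift x i then -Complex.exp (-(Complex.I * ((θ i : ℝ) : ℂ) / (L : ℂ)))
            else 0))) - (if x = y then ((μ : ℝ) : ℂ) else 0)) * torusChar k y.toTorusSite else 0 := by
    intro y
    rw [Fin.sum_univ_two]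
    by_cases hσ : σ = τ
    · subst hσ
      fin_cases σ <;> simp
    · rw [if_neg hσ]
      fin_cases σ <;> fin_cases τ <;> simp_all
  simp only [hσ']
  by_cases hσ : σ = τ
  · simp only [hσ, if_true, sub_mul, Finset.sum_sub_distrib, ite_mul, zero_mul, Finset.sum_ite_eq,
      Finset.mem_univ, Finset.sum_mul, add_mul]
    rw [Finset.sum_comm]
    simp only [Finset.sum_add_distrib, sum_ite_eq_shift_mul_torusChar,
      sum_ite_shift_eq_mul_torusChar, torusChar_add_right, torusChar_sub_right]
    have hi : ∀ i : Fin 2, -Complex.exp (Complex.I * ((θ i : ℝ) : ℂ) / (L : ℂ)) *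
        (torusChar k x.toTorusSite * conj (torusChar k (Pi.single i 1))) +
        -Complex.exp (-(Complex.I * ((θ i : ℝ) : ℂ) / (L : ℂ))) *
          (torusChar k x.toTorusSite * torusChar k (Pi.single i 1)) =
        -(((2 * Real.cos (latticeMomentum L k i - θ i / L) : ℝ) : ℂ) * torusChar k x.toTorusSite) := by
      intro i
      rw [← exp_mul_conj_torusChar_single_add k i (θ i)]
      ring
    rw [← Finset.sum_add_distrib]
    simp only [hi]
    rw [Finset.sum_neg_distrib, ← Finset.sum_mul, twistedBand]
    push_cast
    rw [← Finset.mul_sum]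
    ring
  · simp only [hσ, if_false, Finset.sum_const_zero]

/-! ### The plane-wave unitary and the determinant formula -/

/-- **The plane-wave matrix** on the orbitals of the fermionic torus: its column `o' = (x', σ')` is
the normalised plane wave `L^{-d/2} χ_{x'} ⊗ e_{σ'}` (the site `x'` read as a momentum in
`(ℤ/Lℤ)^d`). Friedli–Velenik 2017 §10.4. [folklore] -/
def planeWaveMatrix (d L : ℕ) [NeZero L] :
    Matrix (Orb (FermionTorus d L)) (Orb (FermionTorus d L)) ℂ :=
  Matrix.of fun o o' => torusFourierWeight d L * planeWave (ofLex o').1.toTorusSite (ofLex o').2 o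

/-- The plane-wave matrix is a co-isometry: `F F⋆ = 1` (completeness of plane waves). [folklore] -/
theorem planeWaveMatrix_mul_conjTranspose {d : ℕ} :
    planeWaveMatrix d L * (planeWaveMatrix d L)ᴴ = 1 := by
  ext o o''
  rw [Matrix.mul_apply, Matrix.one_apply, ← sum_planeWave_mul_conj o o'', sum_orb_eq_sum_sum,
    FermionTorus.sum_eq_sum_torusSite]
  refine Finset.sum_congr rfl fun z _ => Finset.sum_congr rfl fun τ _ => ?_
  simp only [planeWaveMatrix, conjTranspose_apply, Matrix.of_apply, orb, ofLex_toLex,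
    FermionTorus.toTorusSite_ofTorusSite, star_mul', star_torusFourierWeight, Complex.star_def]

/-- `F⋆ F = 1`. [folklore] -/
theorem conjTranspose_planeWaveMatrix_mul {d : ℕ} :
    (planeWaveMatrix d L)ᴴ * planeWaveMatrix d L = 1 :=
  mul_eq_one_comm.mp planeWaveMatrix_mul_conjTranspose

/-- The plane-wave matrix is unitary. [folklore] -/
theorem planeWaveMatrix_mem_unitaryGroup {d : ℕ} :
    planeWaveMatrix d L ∈ Matrix.unitaryGroup (Orb (FermionTorus d L)) ℂ :=
  Matrix.mem_unitaryGroup_iff.mpr planeWaveMatrix_mul_conjTranspose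

/-- The twisted band read off an orbital index `o' = (x', σ')`: `ξ_{x'}(θ,μ)`. [folklore] -/
def twistedBandOrb (L : ℕ) [NeZero L] (θ : Fin 2 → ℝ) (μ : ℝ) (o' : Orb (FermionTorus 2 L)) : ℝ :=
  twistedBand L θ μ (ofLex o').1.toTorusSite

/-- **Diagonalisation**: `h(θ,μ) F = F diag(ξ)`. [cite: ScalapinoWhiteZhang1993, §II] -/
theorem twistedOneBody_mul_planeWaveMatrix (θ : Fin 2 → ℝ) (μ : ℝ) :
    twistedOneBody L θ μ * planeWaveMatrix 2 L =
      planeWaveMatrix 2 L * diagonal (fun o' => ((twistedBandOrb L θ μ o' : ℝ) : ℂ)) := by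
  ext o o'
  rw [Matrix.mul_apply, Matrix.mul_diagonal]
  have h := congrFun (twistedOneBody_mulVec_planeWave θ μ (ofLex o').1.toTorusSite (ofLex o').2) o
  simp only [Matrix.mulVec, dotProduct, Pi.smul_apply, smul_eq_mul] at h
  simp only [planeWaveMatrix, Matrix.of_apply, twistedBandOrb]
  simp_rw [mul_left_comm _ (torusFourierWeight 2 L), ← Finset.mul_sum, h]
  ring

/-- `h(θ,μ) = F diag(ξ) F⋆`. [cite: ScalapinoWhiteZhang1993, §II] -/
theorem twistedOneBody_eq_conj (θ : Fin 2 → ℝ) (μ : ℝ) :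
    twistedOneBody L θ μ = planeWaveMatrix 2 L *
      diagonal (fun o' => ((twistedBandOrb L θ μ o' : ℝ) : ℂ)) * (planeWaveMatrix 2 L)ᴴ := by
  rw [← twistedOneBody_mul_planeWaveMatrix, Matrix.mul_assoc, planeWaveMatrix_mul_conjTranspose,
    Matrix.mul_one]

/-- **The free-gas determinant factorises over momenta**:
`det(1 + a e^{-βh(θ,μ)}) = ∏_{(k,τ)} (1 + a e^{-βξ_k(θ,μ)})`. [folklore] -/
theorem det_one_add_smul_gibbsWeight_twistedOneBody (a : ℂ) (β : ℝ) (θ : Fin 2 → ℝ) (μ : ℝ) :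
    (1 + a • gibbsWeight β (twistedOneBody L θ μ)).det =
      ∏ o' : Orb (FermionTorus 2 L), (1 + a * ((Real.exp (-(β * twistedBandOrb L θ μ o')) : ℝ) : ℂ)) := by
  set F : Matrix (Orb (FermionTorus 2 L)) (Orb (FermionTorus 2 L)) ℂ := planeWaveMatrix 2 L with hF
  set ξ : Orb (FermionTorus 2 L) → ℝ := twistedBandOrb L θ μ with hξ
  have hFF : F * Fᴴ = 1 := planeWaveMatrix_mul_conjTranspose
  have hFinv : F⁻¹ = Fᴴ := Matrix.inv_eq_right_inv hFF
  have hFdet : IsUnit F.det := Matrix.isUnit_det_of_right_inverse hFF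
  have hFunit : IsUnit F := (Matrix.isUnit_iff_isUnit_det _).mpr hFdet
  have hsmul : -(β : ℂ) • twistedOneBody L θ μ =
      F * diagonal (fun o' => -(β : ℂ) * (ξ o' : ℂ)) * F⁻¹ := by
    rw [twistedOneBody_eq_conj, hFinv, ← Matrix.smul_mul, ← Matrix.mul_smul, ← diagonal_smul]
    rfl
  have hD : NormedSpace.exp (diagonal fun o' => -(β : ℂ) * (ξ o' : ℂ)) =
      diagonal (fun o' => ((Real.exp (-(β * ξ o')) : ℝ) : ℂ)) := by
    rw [Matrix.exp_diagonal]
    congr 1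
    funext o'
    rw [Pi.exp_def, Complex.ofReal_exp, Complex.exp_eq_exp_ℂ]
    push_cast
    ring_nf
  have hexp : gibbsWeight β (twistedOneBody L θ μ) =
      F * diagonal (fun o' => ((Real.exp (-(β * ξ o')) : ℝ) : ℂ)) * F⁻¹ := by
    rw [gibbsWeight, hsmul, Matrix.exp_conj _ _ hFunit, hD]
  have h1 : 1 + a • (F * diagonal (fun o' => ((Real.exp (-(β * ξ o')) : ℝ) : ℂ)) * F⁻¹) =
      F * (1 + a • diagonal (fun o' => ((Real.exp (-(β * ξ o')) : ℝ) : ℂ))) * F⁻¹ := by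
    rw [Matrix.mul_add, Matrix.add_mul, Matrix.mul_one, Matrix.mul_nonsing_inv _ hFdet, Matrix.mul_smul,
      Matrix.smul_mul]
  rw [hexp, h1, Matrix.det_conj hFunit, ← diagonal_smul, ← diagonal_one, diagonal_add, det_diagonal]
  rfl

/-- Products over orbitals are double products over momenta and spins. [folklore] -/
theorem prod_orb_twistedBandOrb (θ : Fin 2 → ℝ) (μ : ℝ) (g : ℝ → ℂ) :
    ∏ o' : Orb (FermionTorus 2 L), g (twistedBandOrb L θ μ o') =
      ∏ k : TorusSite 2 L, g (twistedBand L θ μ k) ^ 2 := by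
  rw [← (toLex : FermionTorus 2 L × Fin 2 ≃ Orb (FermionTorus 2 L)).prod_comp, Fintype.prod_prod_type]
  refine Fintype.prod_equiv FermionTorus.equivTorusSite _ _ fun x => ?_
  rw [Fin.prod_univ_two, sq]
  rfl

/-! ### The free twisted gas: partition function and parity-twisted trace in closed form -/

/-- The free-fermion trace formula `tr e^{-β dΓ(h)} = det(1 + e^{-βh})`, stated for an arbitrary
`DecidableEq` instance on the one-particle index (the orbitals of the fermionic torus carry the
`Lex` instance, not the one derived from the linear order). Dereziński–Gérard §17.2. [folklore] -/
theorem partitionFn_dGamma_eq_det_decEq {ι : Type} [DecidableEq ι] [LinearOrder ι] [Fintype ι]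
    {h : Matrix ι ι ℂ} (hh : h.IsHermitian) (β : ℝ) :
    partitionFn β (dGamma h) = (1 + gibbsWeight β h).det := by
  have e : (‹DecidableEq ι› : DecidableEq ι) = LinearOrder.toDecidableEq := Subsingleton.elim _ _
  subst e
  exact partitionFn_dGamma_eq_det_holds ι β h hh

/-- The parity-twisted trace formula `tr ((-1)^N e^{-β dΓ(h)}) = det(1 - e^{-βh})`, for an arbitrary
`DecidableEq` instance on the one-particle index. Dereziński–Gérard §17.2. [folklore] -/
theorem trace_parityOp_mul_gibbsWeight_dGamma_decEq {ι : Type*} [DecidableEq ι] [LinearOrder ι]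
    [Fintype ι] {h : Matrix ι ι ℂ} (hh : h.IsHermitian) (β : ℝ) :
    ((parityOp : Matrix (Finset ι) (Finset ι) ℂ) * gibbsWeight β (dGamma h)).trace =
      (1 - gibbsWeight β h).det := by
  have e : (‹DecidableEq ι› : DecidableEq ι) = LinearOrder.toDecidableEq := Subsingleton.elim _ _
  subst e
  exact trace_parityOp_mul_gibbsWeight_dGamma hh β

/-- **The grand-canonical partition function of the free twisted gas**:
`tr e^{-β dΓ(h(θ,μ))} = ∏_k (1 + e^{-βξ_k(θ,μ)})²`. Dereziński–Gérard §17.2 with the plane-wave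
diagonalisation. [folklore] -/
theorem partitionFn_dGamma_twistedOneBody (β : ℝ) (θ : Fin 2 → ℝ) (μ : ℝ) :
    partitionFn β (dGamma (twistedOneBody L θ μ)) =
      ((∏ k : TorusSite 2 L, (1 + Real.exp (-(β * twistedBand L θ μ k))) ^ 2 : ℝ) : ℂ) := by
  rw [partitionFn_dGamma_eq_det_decEq (twistedOneBody_isHermitian (L := L) θ μ)]
  have h1 := det_one_add_smul_gibbsWeight_twistedOneBody (L := L) 1 β θ μ
  rw [one_smul] at h1
  simp only [one_mul] at h1
  rw [h1, prod_orb_twistedBandOrb θ μ (fun r => 1 + ((Real.exp (-(β * r)) : ℝ) : ℂ))]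
  push_cast
  rfl

/-- **The parity-twisted trace of the free twisted gas**:
`tr ((-1)^N e^{-β dΓ(h(θ,μ))}) = ∏_k (1 - e^{-βξ_k(θ,μ)})²` — a perfect square, hence `≥ 0`.
Dereziński–Gérard §17.2 (`Γ(-γ)`) with the plane-wave diagonalisation. [folklore] -/
theorem trace_parityOp_mul_gibbsWeight_dGamma_twistedOneBody (β : ℝ) (θ : Fin 2 → ℝ) (μ : ℝ) :
    ((parityOp : Matrix (Finset (Orb (FermionTorus 2 L))) (Finset (Orb (FermionTorus 2 L))) ℂ) *
        gibbsWeight β (dGamma (twistedOneBody L θ μ))).trace =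
      ((∏ k : TorusSite 2 L, (1 - Real.exp (-(β * twistedBand L θ μ k))) ^ 2 : ℝ) : ℂ) := by
  rw [trace_parityOp_mul_gibbsWeight_dGamma_decEq (twistedOneBody_isHermitian (L := L) θ μ)]
  have h1 := det_one_add_smul_gibbsWeight_twistedOneBody (L := L) (-1) β θ μ
  rw [neg_one_smul, ← sub_eq_add_neg] at h1
  simp only [neg_one_mul, ← sub_eq_add_neg] at h1
  rw [h1, prod_orb_twistedBandOrb θ μ (fun r => 1 - ((Real.exp (-(β * r)) : ℝ) : ℂ))]
  push_cast
  rfl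

end Literature.MathematicalPhysics.QuantumLattice
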